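import Literature.AlgebraicGeometry.Frobenioids.ModelFrobenioidAutAction
import Literature.IUT.HodgeTheaters.ConventionsCatIsomorphismGroup
import HarnessLib

/-!
# Frobenioids I, Thm. 5.2 (i): the twist of a model Frobenioid by a natural AUTOMORPHISM of its
# rational-function monoid `B` — a self-equivalence lying over the identity of the base which is
# isomorphic to the identity only if the automorphism is base-inner on divisor-free units (OURS)

Mochizuki, *The geometry of Frobenioids I: the general theory*, Kyushu J. Math. **62** (2008)
293–400, §5 Theorem 5.2 (i) p. 100: a morphism of the model Frobenioid `C` of `(Φ, B, Div_B)` on `D`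
IS the quadruple `(deg_Fr, Base, Div, u)` subject to relation (d), and composition is
`u_{ψ ∘ φ} = Base(φ)^* u_ψ · u_φ^{deg_Fr ψ}` (`ModelFrobenioid.lean`) [cite: MochizukiFrdI2008, Thm. 5.2(i) p.100];
Theorem 5.2 (ii) p. 101: `B` is naturally isomorphic to the functor `O^×((−)^birat)` of birational units
of `C` [cite: MochizukiFrdI2008, Thm. 5.2(ii) p.101].  Consumer locus: Mochizuki, *Inter-universal
Teichmüller theory I*, kurims manuscript (May 2020), Corollary 5.3 (ii) p. 144 l. 14–18 («the natural map
`Isom(¹𝔉, ²𝔉) → Isom(¹𝔇, ²𝔇)` is bijective») and the kernel-form argument printed for (iv), p. 144 l. 40–43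
(«let `α ∈ Ker` … lies over the identity … `α` is [isomorphic to] the identity»)
[cite: Mochizuki2012, Cor. 5.3(ii) p.144] (D-0012 claim key; nothing of that series is asserted here; no
side taken on [IUTchIII] Cor. 3.12); Mochizuki, *The étale theta function …*, Def. 3.6 (iv) p. 78: the
base-field-theoretic hull `𝒞^{bs-fld}` IS the model Frobenioid of `(D, Φ^{bs-fld}, F, F → (Φ^{bs-fld})^gp)`
[cite: MochizukiEtTh2009, Def 3.6 p.78] (in the tree `TemperedFrobenioid.hullCategory Fr =
ModelFrobenioid Fr.bsFldMonoid Fr.cnstFnBsFunctor Fr.divFNatTrans`).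

WHAT THIS FILE PROVES (PROOF-ONLY; theorems about OUR model category `ModelFrobenioid Φ B DivB`, not a
construction of either paper; cell abc-iut, seat abc-iut-L1-t7 gen 11, self-row «HKER-OBSTRUCTION =
UNIT-FUNCTOR AUTOMORPHISM TWIST», service to the L5 HUB [IUTchI] Cor 5.3 (ii) bad slot).  The injectivity
half of [IUTchI] Cor. 5.3 (ii)/(iv) is consumed in the tree as the displayed binder

  `hker : ∀ Ψ : C ≌ C, Nonempty (LiesUnder Base Base Ψ (Equivalence.refl)) → Nonempty (Ψ.functor ≅ 𝟭 C)`

(= `Literature.IUT.HodgeTheaters.RigidOverBase (ModelFrobenioid.baseFunctor Φ B DivB)` by definition;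
`Cor53iiAtBadPlace.lean`, `GenuineFKitMergeInputsBadSlot.lean`), PROVED at the genuine `p`-adic
Frobenioids (`PadicFrd.Datum.hker_genuine`, `PadicFrobenioidSelfEquivalenceUnits.lean`) and displayed as
a LAW at the hull of an abstract tempered-Frobenioid input.  Here, for ANY natural automorphism
`σ : B ≅ B` of the rational-function monoid compatible with `Div_B` (`Div_B(σ u) = Div_B(u)`):
* `exists_unitAutTwist_selfEquivalence` — the UNIT-AUTOMORPHISM TWIST `Ψ_σ : C ≌ C`, identity on objects
  and on `(deg_Fr, Base, Div)`, `u_φ ↦ σ(u_φ)` (a functor by the composition law and the naturality of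
  `σ`; an equivalence with inverse `Ψ_{σ⁻¹}`), lying over `𝟭_D` (through the identity identification of
  its base part), TOGETHER WITH the extraction: if `Ψ_σ ≅ 𝟭_C` then at every `A ∈ Ob(D)` every
  divisor-free `u ∈ B(A)` (`Div_B u = 0`) satisfies `σ_A(u) = e^* u` for some `e ∈ Aut_D(A)` — read off the
  naturality square of `Ψ_σ ≅ 𝟭` at the base-identity linear endomorphism `(1, id, 0, u)` of `(A, 0)`
  (isomorphisms have `deg_Fr = 1` and invertible unit entries);
* `exists_selfEquivalence_over_id_not_iso_id_of_unitAut` / `not_kernelTrivial_of_unitAut` — hence, if at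
  ONE object `A` some divisor-free `u` has `σ_A(u) ≠ e^* u` for every `e ∈ Aut_D(A)`, then `Ψ_σ` lies over
  `𝟭_D` and is NOT `≅ 𝟭_C`, so `hker` FAILS for `Base : C → D`;
* `not_kernelTrivial_of_unitAut_of_fixed` — the usable special case «`Aut_D(A)` fixes `u` and `σ_A u ≠ u`»
  (e.g. inversion on a recorded group of roots of unity of order `≥ 3` at an object with trivial base
  automorphisms).
Reading: `hker` at a model Frobenioid REQUIRES that `B` admit no `Div_B`-preserving natural automorphism
that fails to be base-inner on divisor-free units — a rigidity of the UNIT FUNCTOR (at genuine data this is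
the Kummer-pair / MLF rigidity behind `hker_genuine`); it complements `ModelFrobenioidUnitTwistVacuityWitness`
(conjugation by a divisor-free GLOBAL UNIT `w`, which IS `≅ 𝟭`).  No definition, instance, notation or
`Prop` fact; classical category bookkeeping; nothing here asserts abc proved or refuted; typed ≠ proved.
-/

namespace Literature.AlgebraicGeometry.Frobenioids

open CategoryTheory Opposite Literature.IUT.HodgeTheaters

universe w v u

namespace ModelFrobenioid

variable {D : Type u} [Category.{v} D] {Φ B : Dᵒᵖ ⥤ CommMonCat.{w}} {DivB : B ⟶ monoidGp Φ}
  (σ : B ≅ B)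

/-! ### Bookkeeping for a natural automorphism `σ` of the rational-function monoid `B` -/

/-- Naturality of `σ` in the `pull` spelling: `σ_A(f^* x) = f^*(σ_{A'} x)` for `f : A → A'`.
[cite: MochizukiFrdI2008, Thm. 5.2(i) p.100] -/
theorem unitAut_pull (τ : B ≅ B) {A A' : D} (f : A ⟶ A') (x : B.obj (op A')) :
    (τ.hom.app (op A)).hom (pull B f x) = pull B f ((τ.hom.app (op A')).hom x) := by
  have h := congrArg (fun g => g.hom x) (τ.hom.naturality f.op)
  simp only [CommMonCat.hom_comp, MonoidHom.comp_apply] at h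
  exact h

/-- `σ⁻¹(σ u) = u` componentwise. [cite: MochizukiFrdI2008, Thm. 5.2(i) p.100] -/
theorem unitAut_inv_hom_apply (A : Dᵒᵖ) (u : B.obj A) :
    (σ.inv.app A).hom ((σ.hom.app A).hom u) = u := by
  have h := congrArg (fun g => g.hom u) (σ.hom_inv_id_app A)
  simp only [CommMonCat.hom_comp, MonoidHom.comp_apply, CommMonCat.hom_id, MonoidHom.id_apply] at h
  exact h

/-- `σ(σ⁻¹ u) = u` componentwise. [cite: MochizukiFrdI2008, Thm. 5.2(i) p.100] -/
theorem unitAut_hom_inv_apply (A : Dᵒᵖ) (u : B.obj A) :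
    (σ.hom.app A).hom ((σ.inv.app A).hom u) = u :=
  unitAut_inv_hom_apply σ.symm A u

/-- If `σ` preserves `Div_B`, so does `σ⁻¹`. [cite: MochizukiFrdI2008, Thm. 5.2(i) p.100] -/
theorem divB_unitAut_inv
    (hσ : ∀ (A : D) (u : B.obj (op A)),
      divB Φ B DivB (op A) ((σ.hom.app (op A)).hom u) = divB Φ B DivB (op A) u)
    (A : D) (u : B.obj (op A)) :
    divB Φ B DivB (op A) ((σ.inv.app (op A)).hom u) = divB Φ B DivB (op A) u := by
  rw [← hσ A ((σ.inv.app (op A)).hom u), unitAut_hom_inv_apply]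

/-! ### The unit-automorphism twist `Ψ_σ` -/

/-- **The unit-automorphism twist (OURS).**  Let `C` be the model Frobenioid of `(Φ, B, Div_B)` on `D`
([FrdI] Thm. 5.2 (i)) and `σ : B ≅ B` a natural automorphism of the rational-function monoid with
`Div_B(σ u) = Div_B(u)`.  Then there is a self-equivalence `Ψ : C ≌ C` — identity on objects and on
`(deg_Fr, Base, Div)`, `u_φ ↦ σ(u_φ)` — with an identification `η : Ψ ⋙ Base ≅ Base` (componentwise the
identity) such that: `Ψ` preserves Frobenius degrees; `Div(Ψ φ) = η^* Div(φ)`; `u_{Ψ φ} = η^*(σ(u_φ))`;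
`Ψ` lies over `𝟭_D` in the `LiesUnder` currency of [IUTchI] Cor. 5.3; and IF `Ψ ≅ 𝟭_C` THEN for every
`A ∈ Ob(D)`, every class `α` and every divisor-free `u ∈ B(A)` there is `e ∈ Aut_D(A)` with
`σ_A(u) = e^* u` (naturality at the base-identity linear endomorphism `(1, id, 0, u)` of `(A, α)`).
Not a construction of either paper. [cite: MochizukiFrdI2008, Thm. 5.2(i) p.100] -/
theorem exists_unitAutTwist_selfEquivalence
    (hσ : ∀ (A : D) (u : B.obj (op A)),
      divB Φ B DivB (op A) ((σ.hom.app (op A)).hom u) = divB Φ B DivB (op A) u) :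
    ∃ Ψ : ModelFrobenioid Φ B DivB ≌ ModelFrobenioid Φ B DivB,
      ∃ η : Ψ.functor ⋙ baseFunctor Φ B DivB ≅ baseFunctor Φ B DivB,
        (∀ ⦃X Y : ModelFrobenioid Φ B DivB⦄ (φ : X ⟶ Y), degFr (Ψ.functor.map φ) = degFr φ) ∧
        (∀ ⦃X Y : ModelFrobenioid Φ B DivB⦄ (φ : X ⟶ Y),
            div (Ψ.functor.map φ) = pull Φ (η.hom.app X : (Ψ.functor.obj X).base ⟶ X.base) (div φ)) ∧
        (∀ ⦃X Y : ModelFrobenioid Φ B DivB⦄ (φ : X ⟶ Y),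
            unit (Ψ.functor.map φ) =
              pull B (η.hom.app X : (Ψ.functor.obj X).base ⟶ X.base)
                ((σ.hom.app (op X.base)).hom (unit φ))) ∧
        Nonempty (CatIsomorphism.LiesUnder (baseFunctor Φ B DivB) (baseFunctor Φ B DivB) Ψ
          (CategoryTheory.Equivalence.refl (C := D))) ∧
        (Nonempty (Ψ.functor ≅ 𝟭 (ModelFrobenioid Φ B DivB)) →
          ∀ (A : D) (α : Algebra.GrothendieckGroup (Φ.obj (op A))) (u : B.obj (op A)),
            divB Φ B DivB (op A) u = 1 →
              ∃ e : A ≅ A, (σ.hom.app (op A)).hom u = pull B e.hom u) := by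
  -- the twist by an arbitrary `Div_B`-compatible natural automorphism `τ` of `B`: identity on objects and
  -- on `(deg_Fr, Base, Div)`, `u_φ ↦ τ(u_φ)` — a functor by the composition law of Thm. 5.2 (i) and the
  -- naturality of `τ`
  let T : ∀ τ : B ≅ B, (∀ (A : D) (u : B.obj (op A)),
      divB Φ B DivB (op A) ((τ.hom.app (op A)).hom u) = divB Φ B DivB (op A) u) →
      ModelFrobenioid Φ B DivB ⥤ ModelFrobenioid Φ B DivB := fun τ hτ =>
    { obj := fun X => X
      map := fun {X Y} φ =>
        { degFr := degFr φ
          base := baseMap φ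
          div := div φ
          unit := (τ.hom.app (op X.base)).hom (unit φ)
          rel := by
            rw [hτ]
            exact rel φ }
      map_id := fun X => by
        refine hom_ext rfl rfl rfl ?_
        show (τ.hom.app (op X.base)).hom 1 = 1
        exact map_one _
      map_comp := fun {X Y Z} φ ψ => by
        refine hom_ext rfl rfl rfl ?_
        show (τ.hom.app (op X.base)).hom (pull B (baseMap φ) (unit ψ) * unit φ ^ (degFr ψ : ℕ)) =
          pull B (baseMap φ) ((τ.hom.app (op Y.base)).hom (unit ψ)) *
            (τ.hom.app (op X.base)).hom (unit φ) ^ (degFr ψ : ℕ)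
        rw [map_mul, map_pow, unitAut_pull] }
  have hσ' : ∀ (A : D) (u : B.obj (op A)),
      divB Φ B DivB (op A) ((σ.symm.hom.app (op A)).hom u) = divB Φ B DivB (op A) u :=
    divB_unitAut_inv σ hσ
  -- `Ψ_σ` and its inverse `Ψ_{σ⁻¹}`
  let Ψ : ModelFrobenioid Φ B DivB ⥤ ModelFrobenioid Φ B DivB := T σ hσ
  let Ψ' : ModelFrobenioid Φ B DivB ⥤ ModelFrobenioid Φ B DivB := T σ.symm hσ'
  -- `Ψ_{σ⁻¹} ∘ Ψ_σ = 𝟭` and `Ψ_σ ∘ Ψ_{σ⁻¹} = 𝟭` through identity components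
  let ηE : 𝟭 (ModelFrobenioid Φ B DivB) ≅ Ψ ⋙ Ψ' :=
    NatIso.ofComponents (fun X => Iso.refl X) (fun {X Y} φ => by
      show φ ≫ 𝟙 Y = 𝟙 X ≫ Ψ'.map (Ψ.map φ)
      rw [Category.comp_id, Category.id_comp]
      refine hom_ext rfl rfl rfl ?_
      show unit φ = (σ.symm.hom.app (op X.base)).hom ((σ.hom.app (op X.base)).hom (unit φ))
      exact (unitAut_inv_hom_apply σ (op X.base) (unit φ)).symm)
  let εE : Ψ' ⋙ Ψ ≅ 𝟭 (ModelFrobenioid Φ B DivB) :=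
    NatIso.ofComponents (fun X => Iso.refl X) (fun {X Y} φ => by
      show Ψ.map (Ψ'.map φ) ≫ 𝟙 Y = 𝟙 X ≫ φ
      rw [Category.comp_id, Category.id_comp]
      refine hom_ext rfl rfl rfl ?_
      show (σ.hom.app (op X.base)).hom ((σ.symm.hom.app (op X.base)).hom (unit φ)) = unit φ
      exact unitAut_hom_inv_apply σ (op X.base) (unit φ))
  let E : ModelFrobenioid Φ B DivB ≌ ModelFrobenioid Φ B DivB := CategoryTheory.Equivalence.mk Ψ Ψ' ηE εE
  -- the identity identification of the base part
  let η : E.functor ⋙ baseFunctor Φ B DivB ≅ baseFunctor Φ B DivB :=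
    NatIso.ofComponents (fun X => Iso.refl X.base) (fun {X Y} φ => by
      show baseMap φ ≫ 𝟙 Y.base = 𝟙 X.base ≫ baseMap φ
      rw [Category.comp_id, Category.id_comp])
  refine ⟨E, η, fun X Y φ => rfl, fun X Y φ => ?_, fun X Y φ => ?_,
    ⟨η ≪≫ (baseFunctor Φ B DivB).rightUnitor.symm⟩, fun hiso A α u hu => ?_⟩
  · show div φ = pull Φ (𝟙 X.base) (div φ)
    rw [pull_id]
  · show (σ.hom.app (op X.base)).hom (unit φ) = pull B (𝟙 X.base) ((σ.hom.app (op X.base)).hom (unit φ))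
    rw [pull_id]
  · -- extraction: the naturality square of `ι : Ψ_σ ≅ 𝟭` at the base-identity linear endomorphism
    -- `φ₀ := (1, id, 0, u)` of `X₀ := (A, α)` (a morphism since `Div_B u = 0`)
    obtain ⟨ι⟩ := hiso
    let X₀ : ModelFrobenioid Φ B DivB := ⟨A, α⟩
    let φ₀ : X₀ ⟶ X₀ := mkHom X₀ X₀ 1 (𝟙 A) 1 u (by
      show α ^ ((1 : ℕ+) : ℕ) * Algebra.GrothendieckGroup.of (1 : Φ.obj (op A)) =
        pullGp Φ (𝟙 A) α * divB Φ B DivB (op A) u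
      rw [hu, PNat.one_coe, pow_one, map_one, mul_one, mul_one, pullGp_id])
    -- the component of `ι` at `X₀`, an automorphism of `X₀` (`Ψ_σ X₀ = X₀` on the nose)
    let ιX : X₀ ≅ X₀ := ι.app X₀
    have hnat : Ψ.map φ₀ ≫ ιX.hom = ιX.hom ≫ φ₀ := ι.hom.naturality φ₀
    -- `deg_Fr` of an isomorphism is `1`; its unit entry is invertible
    have hdeg : degFr ιX.hom = 1 := (degFr_hom_eq_one ιX).1
    have hcu : IsUnit (unit ιX.hom) :=
      IsUnit.of_mul_eq_one_right _ (pull_unit_hom_mul_unit_inv ιX.symm)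
    -- unit entries of the two composites: `id^* c · σ(u)^{deg ι} = e^* u · c^1`
    have key := congrArg unit hnat
    change pull B (𝟙 A) (unit ιX.hom) * (σ.hom.app (op A)).hom u ^ (degFr ιX.hom : ℕ) =
        pull B (baseMap ιX.hom) u * unit ιX.hom ^ ((1 : ℕ+) : ℕ) at key
    rw [hdeg, PNat.one_coe, pow_one, pow_one, pull_id, mul_comm] at key
    haveI : IsIso (baseMap ιX.hom) := isIso_baseMap_of_isIso ιX.hom
    exact ⟨asIso (baseMap ιX.hom), (hcu.mul_left_inj).1 key⟩

/-! ### Consequence: `hker` fails as soon as `σ` is not base-inner on some divisor-free unit -/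

/-- **A self-equivalence over the identity of the base that is NOT isomorphic to the identity.**  If the
`Div_B`-compatible natural automorphism `σ` of `B` moves, at some object `A`, some divisor-free
`u ∈ B(A)` off its `Aut_D(A)`-orbit (`σ_A(u) ≠ e^* u` for every `e ∈ Aut_D(A)`), then the unit-automorphism
twist `Ψ_σ` is a self-equivalence of the model Frobenioid lying over `𝟭_D` with `Ψ_σ ≇ 𝟭`.  OUR witness;
not a statement of either paper. [cite: MochizukiFrdI2008, Thm. 5.2(i) p.100] -/
theorem exists_selfEquivalence_over_id_not_iso_id_of_unitAut
    (hσ : ∀ (A : D) (u : B.obj (op A)),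
      divB Φ B DivB (op A) ((σ.hom.app (op A)).hom u) = divB Φ B DivB (op A) u)
    (hw : ∃ (A : D) (u : B.obj (op A)), divB Φ B DivB (op A) u = 1 ∧
      ∀ e : A ≅ A, (σ.hom.app (op A)).hom u ≠ pull B e.hom u) :
    ∃ Ψ : ModelFrobenioid Φ B DivB ≌ ModelFrobenioid Φ B DivB,
      Nonempty (CatIsomorphism.LiesUnder (baseFunctor Φ B DivB) (baseFunctor Φ B DivB) Ψ
        (CategoryTheory.Equivalence.refl (C := D))) ∧
      ¬ Nonempty (Ψ.functor ≅ 𝟭 (ModelFrobenioid Φ B DivB)) := by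
  obtain ⟨Ψ, η, -, -, -, hlies, hext⟩ := exists_unitAutTwist_selfEquivalence σ hσ
  obtain ⟨A, u, hu, hne⟩ := hw
  refine ⟨Ψ, hlies, fun hiso => ?_⟩
  obtain ⟨e, he⟩ := hext hiso A 1 u hu
  exact hne e he

/-- **¬ `hker` (kernel triviality of `Aut(C) → Aut(D)`, the displayed injectivity binder of [IUTchI]
Cor. 5.3 (ii)/(iv) in the tree — by definition `Literature.IUT.HodgeTheaters.RigidOverBase
(ModelFrobenioid.baseFunctor Φ B DivB)`) at any model Frobenioid whose rational-function monoid `B` admits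
a `Div_B`-compatible natural automorphism that is not base-inner on some divisor-free unit.**  The law
«every self-equivalence of `C` lying over `𝟭_D` is `≅ 𝟭_C`» fails there: `Ψ_σ` is a counterexample.
(So `hker` at a model Frobenioid REQUIRES the rigidity «`Aut_{Div_B}(B)` is base-inner on divisor-free
units»; at the genuine `p`-adic Frobenioids this is the content of `PadicFrd.Datum.hker_genuine`.)  OUR
witness; not a statement of either paper. [cite: MochizukiFrdI2008, Thm. 5.2(i) p.100]
[cite: Mochizuki2012, Cor. 5.3(ii) p.144] -/
theorem not_kernelTrivial_of_unitAut
    (hσ : ∀ (A : D) (u : B.obj (op A)),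
      divB Φ B DivB (op A) ((σ.hom.app (op A)).hom u) = divB Φ B DivB (op A) u)
    (hw : ∃ (A : D) (u : B.obj (op A)), divB Φ B DivB (op A) u = 1 ∧
      ∀ e : A ≅ A, (σ.hom.app (op A)).hom u ≠ pull B e.hom u) :
    ¬ ∀ Ψ : ModelFrobenioid Φ B DivB ≌ ModelFrobenioid Φ B DivB,
        Nonempty (CatIsomorphism.LiesUnder (baseFunctor Φ B DivB) (baseFunctor Φ B DivB) Ψ
          (CategoryTheory.Equivalence.refl (C := D))) →
        Nonempty (Ψ.functor ≅ 𝟭 (ModelFrobenioid Φ B DivB)) := by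
  intro hker
  obtain ⟨Ψ, hlies, hnot⟩ := exists_selfEquivalence_over_id_not_iso_id_of_unitAut σ hσ hw
  exact hnot (hker Ψ hlies)

/-- **¬ `hker`, usable special case**: it suffices that at ONE object `A` some divisor-free `u ∈ B(A)` is
FIXED by `Aut_D(A)` (`e^* u = u` for all `e`, e.g. `Aut_D(A)` trivial — the terminal object of a connected
coset category) and MOVED by `σ` (`σ_A u ≠ u`, e.g. `σ` = inversion on a recorded group of roots of unity
of order `≥ 3` containing `u`).  OUR witness; not a statement of either paper.
[cite: MochizukiFrdI2008, Thm. 5.2(i) p.100] [cite: Mochizuki2012, Cor. 5.3(ii) p.144] -/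
theorem not_kernelTrivial_of_unitAut_of_fixed
    (hσ : ∀ (A : D) (u : B.obj (op A)),
      divB Φ B DivB (op A) ((σ.hom.app (op A)).hom u) = divB Φ B DivB (op A) u)
    {A : D} {u : B.obj (op A)} (hu : divB Φ B DivB (op A) u = 1)
    (hfix : ∀ e : A ≅ A, pull B e.hom u = u) (hne : (σ.hom.app (op A)).hom u ≠ u) :
    ¬ ∀ Ψ : ModelFrobenioid Φ B DivB ≌ ModelFrobenioid Φ B DivB,
        Nonempty (CatIsomorphism.LiesUnder (baseFunctor Φ B DivB) (baseFunctor Φ B DivB) Ψ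
          (CategoryTheory.Equivalence.refl (C := D))) →
        Nonempty (Ψ.functor ≅ 𝟭 (ModelFrobenioid Φ B DivB)) :=
  not_kernelTrivial_of_unitAut σ hσ ⟨A, u, hu, fun e he => hne (he.trans (hfix e))⟩

end ModelFrobenioid

end Literature.AlgebraicGeometry.Frobenioids
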